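import Summits.QuantumFields.YangMills.Theorems.VirialFluxGapFixSliceChart
import Summits.QuantumFields.YangMills.Theorems.VirialFluxGapExpChartDomain
import HarnessLib

/-!
# The chart identity on `X_fix` on an INJECTIVITY WINDOW (rest coordinates in the fundamental domain `ball 0 π ∪ {π·e₀}`)
# (layer (B2) of the DIRECT Laplace road to ⟨stmt-QuantumFields-24204⟩ `VirialFluxGap.SharpTwistedLaplace`)

Helper module (free-hands work of width seat ym-line-sfw-p2-w3 g57, cell ym-idea-1; `--supports 24204`).  Sequel of ✓`VirialFluxGapFixSliceChart`.
There the rest window was `univ`, on which the window map `Θ' = fixWindowMap` is NOT injective (the exponential chart wraps), so the identity cannot be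
localised.  Here the rest window is the product `B₂` of FUNDAMENTAL DOMAINS `D = ball 0 π ∪ {π·e₀}` (✓`VirialFluxGapExpChartDomain`: `expPoint|_D` is a
bijection onto `SU(2)`), which is simultaneously ONTO (hypothesis `hsurj` of ✓`ChartTensor`) and an injectivity domain:
* `measurableSet_restDomain`, `restParamMeasure_restrict_restDomain` (`B₂` has full `restParamMeasure`-measure: `expMeasure` lives on `ball 0 π ⊆ D`),
  `surjOn_restChart_domain`, `injOn_restChart_domain`;
* ★★★ `fix_restrict_image_windowMap_domain` — `μ_fix|_{Θ'(Φ × (B₁ × B₂))} = Θ'_*(anchorDensity(z,a) · (Leb³ ⊗ (Leb³ ⊗ restParamMeasure))|_{Φ×(B₁×B₂)})`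
  (`Φ = closedBall 0 r`, `r < π/2`; `B₁ = closedBall 0 R_w`, `R_w < 1`);
* ★★ `injOn_fixWindowMap` — `Θ'` is injective on `Φ × (B₁ × B₂)` (anchors: ✓`injOn_anchorMap`; rest: `injOn_conjChart_domain`);
* ★★ `fix_restrict_image_windowMap_of_subset` — hence the identity LOCALISES to every `S ⊆ Φ × (B₁ × B₂)` with measurable image
  (✓`Literature.Analysis.Asymptotics.chart_restrict_of_injOn_ofReal`) — e.g. `S = Φ ×ˢ closedBall_V 0 R` once the slice is read in Euclidean
  coordinates `V`.
Everything here is PROVED; no definitions, no named facts (namespace `Summit.QuantumFields.YangMills.Theorems.VirialFluxGap.FixSplit`).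
HONEST FRAMING: measure-theoretic plumbing; ⟨24204⟩, ⟨24319⟩ and every rung stay OPEN; the Yang–Mills mass gap (Clay) is NOT touched; no summit is
proved by a line.

## References
* S. Helgason, *Groups and Geometric Analysis* (2000), Ch. I §1 Thm 1.14. [Helgason2000]
* K. W. Breitung, *Asymptotic Approximations for Probability Integrals*, LNM 1592 (1994), §2.3 Definitions 4–5. [Breitung1994]
* G. E. Bredon, *Introduction to Compact Transformation Groups* (1972), Ch. II §§4–5. [Bredon1972]
-/

set_option autoImplicit false

noncomputable section

open MeasureTheory Set Filter Metric
open scoped ENNReal RealInnerProductSpace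
open Literature.MathematicalPhysics.QuantumLattice
open Literature.MathematicalPhysics.QuantumFieldTheory hiding SU2
open Literature.MathematicalPhysics.QuantumFieldTheory.Balaban1983to89.T4HaarSU2ExpChart
open Literature.MathematicalPhysics.QuantumFieldTheory.Balaban1983to89.T4ExpWindowSmallField
open Summit.QuantumFields.YangMills.Theorems.FemtoTransferGap
open Summit.QuantumFields.YangMills.Theorems.FemtoTransferGap.TT
open Summit.QuantumFields.YangMills.Theorems.VirialFluxGap.AnchorSlice
open Summit.QuantumFields.YangMills.Theorems.VirialFluxGap.ConjChart
open Summit.QuantumFields.YangMills.Theorems.VirialFluxGap.ChartTensor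

namespace Summit.QuantumFields.YangMills.Theorems.VirialFluxGap.FixSplit

variable {L : ℕ} [NeZero L] {e₀ : OffIdx L} {y₀ : Site 3 L}

/-! ## §1 The rest window made of fundamental domains -/

variable (L e₀ y₀) in
/-- The rest window `B₂ = Π D` is measurable. [folklore] -/
theorem measurableSet_restDomain : MeasurableSet ((Set.pi univ fun _ : {i : OffIdx L // ¬ i = e₀} => (ball (0 : EuclideanSpace ℝ (Fin 3)) Real.pi ∪ {(Real.pi : ℝ) • EuclideanSpace.single (0 : Fin 3) (1 : ℝ)})) ×ˢ ((Set.pi univ fun _ : Fin (2 * L - 1) => Set.pi univ fun _ : Edge 3 L => (ball (0 : EuclideanSpace ℝ (Fin 3)) Real.pi ∪ {(Real.pi : ℝ) • EuclideanSpace.single (0 : Fin 3) (1 : ℝ)})) ×ˢ (Set.pi univ fun _ : {y : Site 3 L // ¬ y = y₀} => (ball (0 : EuclideanSpace ℝ (Fin 3)) Real.pi ∪ {(Real.pi : ℝ) • EuclideanSpace.single (0 : Fin 3) (1 : ℝ)})))) :=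
  (MeasurableSet.univ_pi fun _ => measurableSet_expDomain).prod
    ((MeasurableSet.univ_pi fun _ => MeasurableSet.univ_pi fun _ => measurableSet_expDomain).prod
      (MeasurableSet.univ_pi fun _ => measurableSet_expDomain))

/-- `expMeasure` gives full measure to the fundamental domain. [folklore] -/
theorem expMeasure_compl_expDomain : expMeasure (ball (0 : EuclideanSpace ℝ (Fin 3)) Real.pi ∪ {(Real.pi : ℝ) • EuclideanSpace.single (0 : Fin 3) (1 : ℝ)})ᶜ = 0 :=
  measure_mono_null (compl_subset_compl.2 ball_subset_expDomain) expMeasure_compl_ball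

/-- A finite product of copies of `expMeasure` gives full measure to `Π D`. [folklore] -/
theorem pi_expMeasure_compl_pi_expDomain {κ : Type*} [Fintype κ] :
    (Measure.pi fun _ : κ => expMeasure) (Set.pi univ fun _ : κ => (ball (0 : EuclideanSpace ℝ (Fin 3)) Real.pi ∪ {(Real.pi : ℝ) • EuclideanSpace.single (0 : Fin 3) (1 : ℝ)}))ᶜ = 0 := by
  classical
  have h : (Set.pi univ fun _ : κ => (ball (0 : EuclideanSpace ℝ (Fin 3)) Real.pi ∪ {(Real.pi : ℝ) • EuclideanSpace.single (0 : Fin 3) (1 : ℝ)}))ᶜ ⊆ ⋃ i : κ, Function.eval i ⁻¹' (ball (0 : EuclideanSpace ℝ (Fin 3)) Real.pi ∪ {(Real.pi : ℝ) • EuclideanSpace.single (0 : Fin 3) (1 : ℝ)})ᶜ := by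
    intro b hb
    simp only [mem_compl_iff, mem_univ_pi, not_forall] at hb
    obtain ⟨i, hi⟩ := hb
    exact mem_iUnion.2 ⟨i, hi⟩
  refine measure_mono_null h ((measure_iUnion_null_iff).2 fun i => ?_)
  exact Measure.pi_eval_preimage_null _ expMeasure_compl_expDomain

/-- **The rest window has full `restParamMeasure`-measure**: `restParamMeasure|_{B₂} = restParamMeasure`. [folklore] -/
theorem restParamMeasure_restrict_restDomain :
    (restParamMeasure L e₀ y₀).restrict ((Set.pi univ fun _ : {i : OffIdx L // ¬ i = e₀} => (ball (0 : EuclideanSpace ℝ (Fin 3)) Real.pi ∪ {(Real.pi : ℝ) • EuclideanSpace.single (0 : Fin 3) (1 : ℝ)})) ×ˢ ((Set.pi univ fun _ : Fin (2 * L - 1) => Set.pi univ fun _ : Edge 3 L => (ball (0 : EuclideanSpace ℝ (Fin 3)) Real.pi ∪ {(Real.pi : ℝ) • EuclideanSpace.single (0 : Fin 3) (1 : ℝ)})) ×ˢ (Set.pi univ fun _ : {y : Site 3 L // ¬ y = y₀} => (ball (0 : EuclideanSpace ℝ (Fin 3)) Real.pi ∪ {(Real.pi : ℝ) • EuclideanSpace.single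 (0 : Fin 3) (1 : ℝ)})))) = restParamMeasure L e₀ y₀ := by
  haveI : SFinite (restParamMeasure L e₀ y₀) := by unfold restParamMeasure; infer_instance
  refine Measure.restrict_eq_self_of_ae_mem ?_
  rw [ae_iff]
  have h1 : (Measure.pi fun _ : {i : OffIdx L // ¬ i = e₀} => expMeasure) (Set.pi univ fun _ => (ball (0 : EuclideanSpace ℝ (Fin 3)) Real.pi ∪ {(Real.pi : ℝ) • EuclideanSpace.single (0 : Fin 3) (1 : ℝ)}))ᶜ = 0 :=
    pi_expMeasure_compl_pi_expDomain
  have h2 : (Measure.pi fun _ : Fin (2 * L - 1) => Measure.pi fun _ : Edge 3 L => expMeasure)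
      (Set.pi univ fun _ : Fin (2 * L - 1) => Set.pi univ fun _ : Edge 3 L => (ball (0 : EuclideanSpace ℝ (Fin 3)) Real.pi ∪ {(Real.pi : ℝ) • EuclideanSpace.single (0 : Fin 3) (1 : ℝ)}))ᶜ = 0 := by
    classical
    have h : (Set.pi univ fun _ : Fin (2 * L - 1) => Set.pi univ fun _ : Edge 3 L => (ball (0 : EuclideanSpace ℝ (Fin 3)) Real.pi ∪ {(Real.pi : ℝ) • EuclideanSpace.single (0 : Fin 3) (1 : ℝ)}))ᶜ ⊆
        ⋃ j : Fin (2 * L - 1), Function.eval j ⁻¹' (Set.pi univ fun _ : Edge 3 L => (ball (0 : EuclideanSpace ℝ (Fin 3)) Real.pi ∪ {(Real.pi : ℝ) • EuclideanSpace.single (0 : Fin 3) (1 : ℝ)}))ᶜ := by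
      intro b hb
      simp only [mem_compl_iff, mem_univ_pi, not_forall] at hb
      obtain ⟨j, hj⟩ := hb
      exact mem_iUnion.2 ⟨j, by simpa [mem_univ_pi] using hj⟩
    refine measure_mono_null h ((measure_iUnion_null_iff).2 fun j => ?_)
    exact Measure.pi_eval_preimage_null _ pi_expMeasure_compl_pi_expDomain
  have h3 : (Measure.pi fun _ : {y : Site 3 L // ¬ y = y₀} => expMeasure) (Set.pi univ fun _ => (ball (0 : EuclideanSpace ℝ (Fin 3)) Real.pi ∪ {(Real.pi : ℝ) • EuclideanSpace.single (0 : Fin 3) (1 : ℝ)}))ᶜ = 0 :=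
    pi_expMeasure_compl_pi_expDomain
  have hsub : {b : RestParam L e₀ y₀ | ¬ b ∈ ((Set.pi univ fun _ : {i : OffIdx L // ¬ i = e₀} => (ball (0 : EuclideanSpace ℝ (Fin 3)) Real.pi ∪ {(Real.pi : ℝ) • EuclideanSpace.single (0 : Fin 3) (1 : ℝ)})) ×ˢ ((Set.pi univ fun _ : Fin (2 * L - 1) => Set.pi univ fun _ : Edge 3 L => (ball (0 : EuclideanSpace ℝ (Fin 3)) Real.pi ∪ {(Real.pi : ℝ) • EuclideanSpace.single (0 : Fin 3) (1 : ℝ)})) ×ˢ (Set.pi univ fun _ : {y : Site 3 L // ¬ y = y₀} => (ball (0 : EuclideanSpace ℝ (Fin 3)) Real.pi ∪ {(Real.pi : ℝ) • EuclideanSpace.single (0 : Fin 3) (1 : ℝ)}))))} ⊆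
      ((Set.pi univ fun _ => (ball (0 : EuclideanSpace ℝ (Fin 3)) Real.pi ∪ {(Real.pi : ℝ) • EuclideanSpace.single (0 : Fin 3) (1 : ℝ)}))ᶜ ×ˢ (univ : Set ((Fin (2 * L - 1) → Edge 3 L → EuclideanSpace ℝ (Fin 3)) ×
        ({y : Site 3 L // ¬ y = y₀} → EuclideanSpace ℝ (Fin 3))))) ∪
      ((univ : Set ({i : OffIdx L // ¬ i = e₀} → EuclideanSpace ℝ (Fin 3))) ×ˢ
        (((Set.pi univ fun _ : Fin (2 * L - 1) => Set.pi univ fun _ : Edge 3 L => (ball (0 : EuclideanSpace ℝ (Fin 3)) Real.pi ∪ {(Real.pi : ℝ) • EuclideanSpace.single (0 : Fin 3) (1 : ℝ)}))ᶜ ×ˢ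
          (univ : Set ({y : Site 3 L // ¬ y = y₀} → EuclideanSpace ℝ (Fin 3)))) ∪
         ((univ : Set (Fin (2 * L - 1) → Edge 3 L → EuclideanSpace ℝ (Fin 3))) ×ˢ (Set.pi univ fun _ => (ball (0 : EuclideanSpace ℝ (Fin 3)) Real.pi ∪ {(Real.pi : ℝ) • EuclideanSpace.single (0 : Fin 3) (1 : ℝ)}))ᶜ))) := by
    rintro ⟨b₁, b₂, b₃⟩ hb
    simp only [mem_setOf_eq, mem_prod, not_and_or] at hb
    simp only [mem_union, mem_prod, mem_univ, true_and, and_true, mem_compl_iff]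
    tauto
  refine measure_mono_null hsub ?_
  rw [restParamMeasure]
  refine measure_union_null ?_ ?_
  · rw [Measure.prod_prod, h1, zero_mul]
  · rw [Measure.prod_prod]
    refine mul_eq_zero_of_right _ (measure_union_null ?_ ?_)
    · rw [Measure.prod_prod, h2, zero_mul]
    · rw [Measure.prod_prod, h3, mul_zero]

omit [NeZero L] in
/-- `restChart R k` maps the rest window onto `FixRest`. [folklore] -/
theorem surjOn_restChart_domain (R : FixRest L e₀ y₀) (k : SU2) : SurjOn (restChart R k) ((Set.pi univ fun _ : {i : OffIdx L // ¬ i = e₀} => (ball (0 : EuclideanSpace ℝ (Fin 3)) Real.pi ∪ {(Real.pi : ℝ) • EuclideanSpace.single (0 : Fin 3) (1 : ℝ)})) ×ˢ ((Set.pi univ fun _ : Fin (2 * L - 1) => Set.pi univ fun _ : Edge 3 L => (ball (0 : EuclideanSpace ℝ (Fin 3)) Real.pi ∪ {(Real.pi : ℝ) • EuclideanSpace.single (0 : Fin 3) (1 : ℝ)})) ×ˢ (Set.pi univ fun _ : {y : Site 3 L // ¬ y = y₀} => (ball (0 : EuclideanSpace ℝ (Fin 3)) Real.pi ∪ {(Real.pi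 : ℝ) • EuclideanSpace.single (0 : Fin 3) (1 : ℝ)})))) univ := by
  rintro ⟨r₁, f, r₃⟩ -
  choose b₁ hb₁ hb₁' using fun i => surjOn_conjChart_domain k (R.1 i) (mem_univ (r₁ i))
  choose b₂ hb₂ hb₂' using fun j e => surjOn_conjChart_domain k (R.2.1 j e) (mem_univ (f j e))
  choose b₃ hb₃ hb₃' using fun y => surjOn_conjChart_domain k (R.2.2 y) (mem_univ (r₃ y))
  refine ⟨(b₁, (b₂, b₃)), ⟨fun i _ => hb₁ i, fun j _ e _ => hb₂ j e, fun y _ => hb₃ y⟩, ?_⟩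
  simp only [restChart]
  exact Prod.ext (funext fun i => hb₁' i) (Prod.ext (funext fun j => funext fun e => hb₂' j e) (funext fun y => hb₃' y))

omit [NeZero L] in
/-- `restChart R k` is injective on the rest window. [folklore] -/
theorem injOn_restChart_domain (R : FixRest L e₀ y₀) (k : SU2) : InjOn (restChart R k) ((Set.pi univ fun _ : {i : OffIdx L // ¬ i = e₀} => (ball (0 : EuclideanSpace ℝ (Fin 3)) Real.pi ∪ {(Real.pi : ℝ) • EuclideanSpace.single (0 : Fin 3) (1 : ℝ)})) ×ˢ ((Set.pi univ fun _ : Fin (2 * L - 1) => Set.pi univ fun _ : Edge 3 L => (ball (0 : EuclideanSpace ℝ (Fin 3)) Real.pi ∪ {(Real.pi : ℝ) • EuclideanSpace.single (0 : Fin 3) (1 : ℝ)})) ×ˢ (Set.pi univ fun _ : {y : Site 3 L // ¬ y = y₀} => (ball (0 : EuclideanSpace ℝ (Fin 3)) Real.pi ∪ {(Real.pi : ℝ) • EuclideanSpace.single (0 : Fin 3) (1 : ℝ)})))) := by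
  rintro ⟨b₁, b₂, b₃⟩ ⟨hb₁, hb₂, hb₃⟩ ⟨b₁', b₂', b₃'⟩ ⟨hb₁', hb₂', hb₃'⟩ h
  simp only [restChart, Prod.mk.injEq] at h
  obtain ⟨h1, h2, h3⟩ := h
  refine Prod.ext (funext fun i => ?_) (Prod.ext (funext fun j => funext fun e => ?_) (funext fun y => ?_))
  · exact injOn_conjChart_domain k (R.1 i) (hb₁ i (mem_univ _)) (hb₁' i (mem_univ _)) (congrFun h1 i)
  · exact injOn_conjChart_domain k (R.2.1 j e) (hb₂ j (mem_univ _) e (mem_univ _)) (hb₂' j (mem_univ _) e (mem_univ _))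
      (congrFun (congrFun h2 j) e)
  · exact injOn_conjChart_domain k (R.2.2 y) (hb₃ y (mem_univ _)) (hb₃' y (mem_univ _)) (congrFun h3 y)

/-! ## §2 The chart identity on the injectivity window -/

/-- ★★★ **THE CHART IDENTITY `hloc` ON `X_fix`, injectivity-window form** (`B₂ = Π D`).
[cite: Helgason2000, Ch. I §1 Thm 1.14] [cite: Breitung1994, §2.3 Definitions 4–5; Thm 41 p. 56] [cite: Bredon1972, Ch. II §§4–5] -/
theorem fix_restrict_image_windowMap_domain {ωC ωN ωX : EuclideanSpace ℝ (Fin 3)} {C₀ N₀ : SU2} (hC : ‖ωC‖ = 1) (hN : ‖ωN‖ = 1)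
    (hCN : ⟪ωC, ωN⟫ = 0) (hX : imQuat ωX = imQuat ωC * imQuat ωN) (hC₀ : su2Quat C₀ = imQuat ωC)
    (hN₀ : su2Quat N₀ = imQuat ωN ∨ su2Quat N₀ = -imQuat ωN) (R : FixRest L e₀ y₀) {r Rw : ℝ} (hr : r < Real.pi / 2) (hRw : Rw < 1) :
    ((Measure.pi fun _ : OffIdx L => haarProbability SU2).prod
        ((Measure.pi fun _ : Fin (2 * L - 1) => configMeasure SU2 L).prod (gaugeMeasure L))).restrict
        (fixWindowMap ωC ωN ωX C₀ N₀ R ''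
          (closedBall (0 : EuclideanSpace ℝ (Fin 3)) r ×ˢ (closedBall (0 : EuclideanSpace ℝ (Fin 3)) Rw ×ˢ ((Set.pi univ fun _ : {i : OffIdx L // ¬ i = e₀} => (ball (0 : EuclideanSpace ℝ (Fin 3)) Real.pi ∪ {(Real.pi : ℝ) • EuclideanSpace.single (0 : Fin 3) (1 : ℝ)})) ×ˢ ((Set.pi univ fun _ : Fin (2 * L - 1) => Set.pi univ fun _ : Edge 3 L => (ball (0 : EuclideanSpace ℝ (Fin 3)) Real.pi ∪ {(Real.pi : ℝ) • EuclideanSpace.single (0 : Fin 3) (1 : ℝ)})) ×ˢ (Set.pi univ fun _ : {y : Site 3 L // ¬ y = y₀} => (ball (0 : EuclideanSpace ℝ (Fin 3)) Real.pi ∪ {(Real.pi : ℝ) • EuclideanSpace.single (0 : Fin 3) (1 : ℝ)}))))))) =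
      ((((volume : Measure (EuclideanSpace ℝ (Fin 3))).prod
          ((volume : Measure (EuclideanSpace ℝ (Fin 3))).prod (restParamMeasure L e₀ y₀))).restrict
          (closedBall (0 : EuclideanSpace ℝ (Fin 3)) r ×ˢ (closedBall (0 : EuclideanSpace ℝ (Fin 3)) Rw ×ˢ ((Set.pi univ fun _ : {i : OffIdx L // ¬ i = e₀} => (ball (0 : EuclideanSpace ℝ (Fin 3)) Real.pi ∪ {(Real.pi : ℝ) • EuclideanSpace.single (0 : Fin 3) (1 : ℝ)})) ×ˢ ((Set.pi univ fun _ : Fin (2 * L - 1) => Set.pi univ fun _ : Edge 3 L => (ball (0 : EuclideanSpace ℝ (Fin 3)) Real.pi ∪ {(Real.pi : ℝ) • EuclideanSpace.single (0 : Fin 3) (1 : ℝ)})) ×ˢ (Set.pi univ fun _ : {y : Site 3 L // ¬ y = y₀} => (ball (0 : EuclideanSpace ℝ (Fin 3)) Real.pi ∪ {(Real.pi : ℝ) • EuclideanSpace.single (0 : Fin 3) (1 : ℝ)}))))))).withDensity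
        fun w => ENNReal.ofReal (anchorDensity ωC ωN ωX C₀ N₀ (w.1, w.2.1))).map (fixWindowMap ωC ωN ωX C₀ N₀ R) := by
  haveI : IsProbabilityMeasure (gaugeMeasure L) := by unfold gaugeMeasure; infer_instance
  haveI : SigmaFinite (restMeasure L e₀ y₀) := by unfold restMeasure; infer_instance
  haveI : SFinite (restParamMeasure L e₀ y₀) := by unfold restParamMeasure; infer_instance
  -- the parametrised rest chart, uncurried (kept folded: `Function.uncurry` is never unfolded by the kernel here)
  set c : EuclideanSpace ℝ (Fin 3) × RestParam L e₀ y₀ → FixRest L e₀ y₀ :=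
    Function.uncurry fun (z : EuclideanSpace ℝ (Fin 3)) (b : RestParam L e₀ y₀) => restChart R (expPoint z) b with hc
  have hcm : Measurable c := measurable_restChart_param R
  have hcz : ∀ z : EuclideanSpace ℝ (Fin 3), (fun y₂ : RestParam L e₀ y₀ => c (z, y₂)) = restChart R (expPoint z) := fun z => rfl
  -- the tensored identity on `(SU2 × SU2) × FixRest`
  have hT := restrict_image_tensorWindow_eq_map_withDensity
    (κ := (volume : Measure (EuclideanSpace ℝ (Fin 3)))) (ρ₁ := (volume : Measure (EuclideanSpace ℝ (Fin 3))))
    (ρ₂ := restParamMeasure L e₀ y₀) (μ₁ := (haarProbability SU2).prod (haarProbability SU2)) (μ₂ := restMeasure L e₀ y₀)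
    (Θ₁ := anchorMap ωC ωN ωX C₀ N₀) (c := c)
    (Φ := closedBall (0 : EuclideanSpace ℝ (Fin 3)) r) (B₁ := closedBall (0 : EuclideanSpace ℝ (Fin 3)) Rw)
    (B₂ := ((Set.pi univ fun _ : {i : OffIdx L // ¬ i = e₀} => (ball (0 : EuclideanSpace ℝ (Fin 3)) Real.pi ∪ {(Real.pi : ℝ) • EuclideanSpace.single (0 : Fin 3) (1 : ℝ)})) ×ˢ ((Set.pi univ fun _ : Fin (2 * L - 1) => Set.pi univ fun _ : Edge 3 L => (ball (0 : EuclideanSpace ℝ (Fin 3)) Real.pi ∪ {(Real.pi : ℝ) • EuclideanSpace.single (0 : Fin 3) (1 : ℝ)})) ×ˢ (Set.pi univ fun _ : {y : Site 3 L // ¬ y = y₀} => (ball (0 : EuclideanSpace ℝ (Fin 3)) Real.pi ∪ {(Real.pi : ℝ) • EuclideanSpace.single (0 : Fin 3) (1 : ℝ)})))))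
    continuous_anchorMap.measurable hcm measurableSet_closedBall measurableSet_closedBall (measurableSet_restDomain (L := L) e₀ y₀)
    (J₁ := fun w => ENNReal.ofReal (anchorDensity ωC ωN ωX C₀ N₀ w))
    (measurable_anchorDensity (ωC := ωC) (ωN := ωN) (ωX := ωX) (C₀ := C₀) (N₀ := N₀)).ennreal_ofReal
    (J₂ := fun _ => (1 : ℝ≥0∞)) measurable_const
    (haar_prod_restrict_image_anchorMap hC hN hCN hX hC₀ hN₀ hr hRw)
    (fun z _ => by
      rw [hcz z, restParamMeasure_restrict_restDomain, show (fun _ : RestParam L e₀ y₀ => (1 : ℝ≥0∞)) = 1 from rfl, withDensity_one]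
      exact map_restChart R (expPoint z))
    (fun z _ => by rw [hcz z]; exact surjOn_restChart_domain R (expPoint z))
  -- transport along `fixSplit.symm`
  have hpres : MeasurePreserving (fixSplit L e₀ y₀).symm (((haarProbability SU2).prod (haarProbability SU2)).prod (restMeasure L e₀ y₀))
      ((Measure.pi fun _ : OffIdx L => haarProbability SU2).prod
        ((Measure.pi fun _ : Fin (2 * L - 1) => configMeasure SU2 L).prod (gaugeMeasure L))) :=
    (measurePreserving_fixSplit (L := L) e₀ y₀).symm (fixSplit L e₀ y₀)
  have hA : Measurable (anchorMap ωC ωN ωX C₀ N₀) := continuous_anchorMap.measurable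
  have hΘp : Measurable (fun w : EuclideanSpace ℝ (Fin 3) × (EuclideanSpace ℝ (Fin 3) × RestParam L e₀ y₀) =>
      (anchorMap ωC ωN ωX C₀ N₀ (w.1, w.2.1), c (w.1, w.2.2))) :=
    (Measurable.comp (g := anchorMap ωC ωN ωX C₀ N₀) hA (measurable_fst.prodMk (measurable_fst.comp measurable_snd))).prodMk
      (Measurable.comp (g := c) hcm (measurable_fst.prodMk (measurable_snd.comp measurable_snd)))
  have hcomp : fixWindowMap ωC ωN ωX C₀ N₀ R =
      (fixSplit L e₀ y₀).symm ∘ (fun w : EuclideanSpace ℝ (Fin 3) × (EuclideanSpace ℝ (Fin 3) × RestParam L e₀ y₀) =>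
        (anchorMap ωC ωN ωX C₀ N₀ (w.1, w.2.1), c (w.1, w.2.2))) :=
    funext fun w => fixWindowMap_eq ωC ωN ωX C₀ N₀ R w
  rw [← hpres.map_eq, hcomp, image_comp, MeasurableEquiv.restrict_map, (fixSplit L e₀ y₀).symm.injective.preimage_image, hT,
    Measure.map_map (fixSplit L e₀ y₀).symm.measurable hΘp]
  congr 1
  refine withDensity_congr_ae (Filter.Eventually.of_forall fun w => ?_)
  simp only [mul_one]


/-! ## §3 Injectivity of the window map and localisation -/

omit [NeZero L] in
/-- ★★ **The window map is injective on `Φ × (B₁ × B₂)`** (`r < π/2`, `R_w < 1`). [cite: Bredon1972, Ch. II §§4–5] -/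
theorem injOn_fixWindowMap {ωC ωN ωX : EuclideanSpace ℝ (Fin 3)} {C₀ N₀ : SU2} (hC : ‖ωC‖ = 1) (hN : ‖ωN‖ = 1)
    (hCN : ⟪ωC, ωN⟫ = 0) (hX : imQuat ωX = imQuat ωC * imQuat ωN) (hC₀ : su2Quat C₀ = imQuat ωC)
    (hN₀ : su2Quat N₀ = imQuat ωN ∨ su2Quat N₀ = -imQuat ωN) (R : FixRest L e₀ y₀) {r Rw : ℝ} (hr : r < Real.pi / 2) (hRw : Rw < 1) :
    InjOn (fixWindowMap ωC ωN ωX C₀ N₀ R)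
      (closedBall (0 : EuclideanSpace ℝ (Fin 3)) r ×ˢ (closedBall (0 : EuclideanSpace ℝ (Fin 3)) Rw ×ˢ ((Set.pi univ fun _ : {i : OffIdx L // ¬ i = e₀} => (ball (0 : EuclideanSpace ℝ (Fin 3)) Real.pi ∪ {(Real.pi : ℝ) • EuclideanSpace.single (0 : Fin 3) (1 : ℝ)})) ×ˢ ((Set.pi univ fun _ : Fin (2 * L - 1) => Set.pi univ fun _ : Edge 3 L => (ball (0 : EuclideanSpace ℝ (Fin 3)) Real.pi ∪ {(Real.pi : ℝ) • EuclideanSpace.single (0 : Fin 3) (1 : ℝ)})) ×ˢ (Set.pi univ fun _ : {y : Site 3 L // ¬ y = y₀} => (ball (0 : EuclideanSpace ℝ (Fin 3)) Real.pi ∪ {(Real.pi : ℝ) • EuclideanSpace.single (0 : Fin 3) (1 : ℝ)})))))) := by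
  have hRw' : Rw < Real.pi / 2 := by linarith [Real.pi_gt_three]
  intro w hw w' hw' h
  rw [Set.mem_prod, Set.mem_prod] at hw hw'
  have h' : (anchorMap ωC ωN ωX C₀ N₀ (w.1, w.2.1), restChart R (expPoint w.1) w.2.2) =
      (anchorMap ωC ωN ωX C₀ N₀ (w'.1, w'.2.1), restChart R (expPoint w'.1) w'.2.2) :=
    (fixSplit L e₀ y₀).symm.injective
      (((fixWindowMap_eq ωC ωN ωX C₀ N₀ R w).symm.trans h).trans (fixWindowMap_eq ωC ωN ωX C₀ N₀ R w'))
  obtain ⟨h1, h2⟩ := Prod.mk.inj h'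
  have hmem : (w.1, w.2.1) ∈ closedBall (0 : EuclideanSpace ℝ (Fin 3)) r ×ˢ closedBall (0 : EuclideanSpace ℝ (Fin 3)) Rw :=
    Set.mk_mem_prod hw.1 hw.2.1
  have hmem' : (w'.1, w'.2.1) ∈ closedBall (0 : EuclideanSpace ℝ (Fin 3)) r ×ˢ closedBall (0 : EuclideanSpace ℝ (Fin 3)) Rw :=
    Set.mk_mem_prod hw'.1 hw'.2.1
  have hza : (w.1, w.2.1) = (w'.1, w'.2.1) := injOn_anchorMap hC hN hCN hX hC₀ hN₀ hr hRw' hmem hmem' h1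
  obtain ⟨hz, ha⟩ := Prod.mk.inj hza
  rw [hz] at h2
  have hb : w.2.2 = w'.2.2 := injOn_restChart_domain R (expPoint w'.1) hw.2.2 hw'.2.2 h2
  exact Prod.ext hz (Prod.ext ha hb)

/-- ★★ **LOCALISATION**: the chart identity holds on every sub-window `S ⊆ Φ × (B₁ × B₂)` whose image is measurable
(✓`chart_restrict_of_injOn_ofReal`). [cite: Breitung1994, §2.3 Definitions 4–5] -/
theorem fix_restrict_image_windowMap_of_subset {ωC ωN ωX : EuclideanSpace ℝ (Fin 3)} {C₀ N₀ : SU2} (hC : ‖ωC‖ = 1) (hN : ‖ωN‖ = 1)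
    (hCN : ⟪ωC, ωN⟫ = 0) (hX : imQuat ωX = imQuat ωC * imQuat ωN) (hC₀ : su2Quat C₀ = imQuat ωC)
    (hN₀ : su2Quat N₀ = imQuat ωN ∨ su2Quat N₀ = -imQuat ωN) (R : FixRest L e₀ y₀) {r Rw : ℝ} (hr : r < Real.pi / 2) (hRw : Rw < 1)
    {S : Set (EuclideanSpace ℝ (Fin 3) × (EuclideanSpace ℝ (Fin 3) × RestParam L e₀ y₀))}
    (hS : S ⊆ closedBall (0 : EuclideanSpace ℝ (Fin 3)) r ×ˢ (closedBall (0 : EuclideanSpace ℝ (Fin 3)) Rw ×ˢ ((Set.pi univ fun _ : {i : OffIdx L // ¬ i = e₀} => (ball (0 : EuclideanSpace ℝ (Fin 3)) Real.pi ∪ {(Real.pi : ℝ) • EuclideanSpace.single (0 : Fin 3) (1 : ℝ)})) ×ˢ ((Set.pi univ fun _ : Fin (2 * L - 1) => Set.pi univ fun _ : Edge 3 L => (ball (0 : EuclideanSpace ℝ (Fin 3)) Real.pi ∪ {(Real.pi : ℝ) • EuclideanSpace.single (0 : Fin 3) (1 : ℝ)})) ×ˢ (Set.pi univ fun _ : {y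 : Site 3 L // ¬ y = y₀} => (ball (0 : EuclideanSpace ℝ (Fin 3)) Real.pi ∪ {(Real.pi : ℝ) • EuclideanSpace.single (0 : Fin 3) (1 : ℝ)}))))))
    (hSm : MeasurableSet (fixWindowMap ωC ωN ωX C₀ N₀ R '' S)) :
    ((Measure.pi fun _ : OffIdx L => haarProbability SU2).prod
        ((Measure.pi fun _ : Fin (2 * L - 1) => configMeasure SU2 L).prod (gaugeMeasure L))).restrict
        (fixWindowMap ωC ωN ωX C₀ N₀ R '' S) =
      ((((volume : Measure (EuclideanSpace ℝ (Fin 3))).prod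
          ((volume : Measure (EuclideanSpace ℝ (Fin 3))).prod (restParamMeasure L e₀ y₀))).restrict S).withDensity
        fun w => ENNReal.ofReal (anchorDensity ωC ωN ωX C₀ N₀ (w.1, w.2.1))).map (fixWindowMap ωC ωN ωX C₀ N₀ R) := by
  have hmeas : Measurable (fixWindowMap ωC ωN ωX C₀ N₀ R) := by
    have hcomp : fixWindowMap ωC ωN ωX C₀ N₀ R =
        (fixSplit L e₀ y₀).symm ∘ (fun w : EuclideanSpace ℝ (Fin 3) × (EuclideanSpace ℝ (Fin 3) × RestParam L e₀ y₀) =>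
          (anchorMap ωC ωN ωX C₀ N₀ (w.1, w.2.1),
            (Function.uncurry fun (z : EuclideanSpace ℝ (Fin 3)) (b : RestParam L e₀ y₀) => restChart R (expPoint z) b) (w.1, w.2.2))) :=
      funext fun w => fixWindowMap_eq ωC ωN ωX C₀ N₀ R w
    rw [hcomp]
    refine (fixSplit L e₀ y₀).symm.measurable.comp ?_
    exact (Measurable.comp (g := anchorMap ωC ωN ωX C₀ N₀) continuous_anchorMap.measurable
      (measurable_fst.prodMk (measurable_fst.comp measurable_snd))).prodMk
      (Measurable.comp (g := Function.uncurry fun (z : EuclideanSpace ℝ (Fin 3)) (b : RestParam L e₀ y₀) => restChart R (expPoint z) b)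
        (measurable_restChart_param R) (measurable_fst.prodMk (measurable_snd.comp measurable_snd)))
  exact Literature.Analysis.Asymptotics.chart_restrict_of_injOn_ofReal hmeas (injOn_fixWindowMap hC hN hCN hX hC₀ hN₀ R hr hRw) hS hSm
    (fix_restrict_image_windowMap_domain hC hN hCN hX hC₀ hN₀ R hr hRw)

end Summit.QuantumFields.YangMills.Theorems.VirialFluxGap.FixSplit

end
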